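import Summits.HodgeConjecture.HodgeConjecture.Cruxes.BlochSeedDiscOne.BoxIdentity

/-!
# AxisPhaseSlab — the slab row of an AXIS letter, alphabet-wide (dual's ×2 half of the NU4₄ port, ingredient (1a′)), and
«same ray, same phase» for null steps between charged axis letters (ingredient (1d′))
(plan-lens-HodgeAV-dual g18, 2026-08-31; asked by officer idea-crit-6 g24 AUDIT BLOCK 36 and director-hodge g30 R19.752 (1)(c)
«(M1₄) ⇐ THEOREM NU4₄ … officer∕dual ×2 required»; the theorem under audit is negation g23 `Cruxes/BlochSeedDiscOne/NU4S-negation-g23.md` §4.)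

`line stmt-HodgeConjecture-18881 Cruxes/BlochSeedDiscOne/Lines/birth.lean 814a6a70c14e831a stub_rung_pad4_seedAt`
KERNEL STATEMENTS ONLY — no `sorry`, no new axiom, no `instance`, no `notation`.  **Nothing here is proved toward HC ∕ HC_CM ∕ HC_AV ∕
№4 ∕ 26512 ∕ 18881 ∕ H2.**  Letters ≠ sheaves ≠ SEED.  This file does NOT prove NU4₄ or (M1₄); it certifies two letter-level DICTIONARY
entries of the port, for EVERY height `hgt` and EVERY co-level `r` (the memo needs `r = 1, 2, 3` at height 14):

* (1a′) `slab_axisLetter` — the axis letter of co-level `r` at phase `τ`, `axisLetter hgt r τ = (hgt − r; r·i^τ)`, has slab row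
  `slab_t = 2r·[t ∈ {τ+1, τ+2}]` (indices mod 4).  This IS the alphabet-wide reading of the `BoxIdentity` §4 sanity rows
  `u = (13;1,0) ↦ (0,2,2,0)`, `C = (11;3,0) ↦ (0,6,6,0)` (both `τ = 0`), and it holds for all integers `hgt`, `r` with no hypothesis
  (the slab functional is affine).  `eq_axisLetter_of_axis`: every axis letter ON THE ALPHABET is `axisLetter hgt (colevel) τ` for some
  `τ`, so the row applies to every axis letter of every supported cell.  Cell level: `psi_axisCell` — for an axis cell with co-levels
  `r_f` and phases `τ_f`, `ψ_x(c) = 16·∏ r_f = 16·dep(c)` if `x_f ∈ {τ_f+1, τ_f+2}` for all four slots («`x ∈ boxes(τ)`», 16 boxes)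
  and `0` otherwise — negation's «ψ_x(c) = 16·dep(c)·[x ∈ boxes(τ(c))] for EVERY axis cell», hence NU4 (1a) `s_x − t_x = T′_{k(x)}`
  reads verbatim at shell 4 with hub-free N cells over `{u, A, C}`.
* (1d′) `nullStep_axisLetter_iff` — a null step FROM the axis letter `(hgt − r′; r′·i^{τ′})` UP TO the axis letter `(hgt − r; r·i^τ)`
  with `0 < r`, `0 < r′` holds IFF `τ′ = τ ∧ r < r′`: a null step between two CHARGED AXIS letters keeps the open ray (same phase) and
  strictly raises the co-level downward — with NO length bound (the memo's route via `axis_of_sq_add_sq` needs length `≤ 4`; between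
  axis letters the cross terms `2rr′ = 0` ∕ `4rr′ = 0` do it for every length).  So once a supplier letter of an axis hub-free N letter
  is known to be a charged AXIS letter (negation's order of argument, officer's sharpening S1: hub-free first, axis by (R2) + the
  room, then this lemma), it sits on the SAME ray at the SAME phase with larger co-level: `boxes(x) = boxes(τ)`, `dep(x) > dep(y)`.
-/

namespace Summit.HodgeConjecture.HodgeConjecture.Cruxes.BlochSeedDiscOne.AxisPhaseSlab

open Summit.HodgeConjecture.HodgeConjecture.Cruxes.BlochSeedDiscOne.DepthBoundA4
open Summit.HodgeConjecture.HodgeConjecture.Cruxes.BlochSeedDiscOne.LeggedFloor (NullStep)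
open Summit.HodgeConjecture.HodgeConjecture.Cruxes.BlochSeedDiscOne.BoxIdentity

/-- the AXIS letter of co-level `r` at phase `τ ∈ ℤ₄` on the height-`hgt` alphabet: `(hgt − r; r·i^τ)`, i.e.
`τ = 0 ↦ (r, 0)`, `1 ↦ (0, r)`, `2 ↦ (−r, 0)`, `3 ↦ (0, −r)`. -/
def axisLetter (hgt r : ℤ) (τ : Fin 4) : Letter :=
  match τ with
  | 0 => ⟨hgt - r, r, 0⟩
  | 1 => ⟨hgt - r, 0, r⟩
  | 2 => ⟨hgt - r, -r, 0⟩
  | 3 => ⟨hgt - r, 0, -r⟩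

theorem axisLetter_a (hgt r : ℤ) (τ : Fin 4) : (axisLetter hgt r τ).a = hgt - r := by
  fin_cases τ <;> rfl

theorem colevel_axisLetter (hgt r : ℤ) (τ : Fin 4) (hr : 0 ≤ r) : (axisLetter hgt r τ).colevel = r := by
  fin_cases τ <;> simp [axisLetter, Letter.colevel, abs_of_nonneg hr]

theorem axisLetter_onAlphabet (hgt r : ℤ) (τ : Fin 4) (hr : 0 ≤ r) (hrh : r ≤ hgt) :
    (axisLetter hgt r τ).OnAlphabet hgt := by
  fin_cases τ <;> simp [axisLetter, Letter.OnAlphabet, Letter.height, abs_of_nonneg hr] <;> omega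

/-- co-level `0`: the axis letter is the hub, at every phase. -/
theorem axisLetter_zero (hgt : ℤ) (τ : Fin 4) : axisLetter hgt 0 τ = Letter.hub hgt := by
  fin_cases τ <;> simp [axisLetter, Letter.hub]

/-- an axis letter is an axis letter: `x = 0 ∨ y = 0`. -/
theorem axisLetter_axis (hgt r : ℤ) (τ : Fin 4) : (axisLetter hgt r τ).x = 0 ∨ (axisLetter hgt r τ).y = 0 := by
  fin_cases τ <;> simp [axisLetter]

/-! ## (1a′) the slab row of an axis letter -/

/-- **(1a′) SLAB ROW OF AN AXIS LETTER (every height, every co-level, no hypothesis).**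
`slab_t(hgt − r; r·i^τ) = 2r` if `t ∈ {τ + 1, τ + 2}` and `0` otherwise. -/
theorem slab_axisLetter (hgt r : ℤ) (τ t : Fin 4) :
    slab hgt t (axisLetter hgt r τ) = if t = τ + 1 ∨ t = τ + 2 then 2 * r else 0 := by
  fin_cases τ <;> fin_cases t <;> simp [slab, spro, axisLetter] <;> omega

/-- the two `BoxIdentity` §4 sanity rows are the instances `hgt = 14`, `τ = 0`, `r = 1` (`u`) and `r = 3` (`C`);
`r = 2` (`A = (12; 2, 0) ↦ (0,4,4,0)`) and `r = 4` (`E = (10; 4, 0) ↦ (0,8,8,0)`) likewise. -/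
example : (slab 14 0 (axisLetter 14 1 0), slab 14 1 (axisLetter 14 1 0), slab 14 2 (axisLetter 14 1 0),
    slab 14 3 (axisLetter 14 1 0)) = (0, 2, 2, 0) := by decide
example : (slab 14 0 (axisLetter 14 2 0), slab 14 1 (axisLetter 14 2 0), slab 14 2 (axisLetter 14 2 0),
    slab 14 3 (axisLetter 14 2 0)) = (0, 4, 4, 0) := by decide
example : (slab 14 0 (axisLetter 14 3 0), slab 14 1 (axisLetter 14 3 0), slab 14 2 (axisLetter 14 3 0),
    slab 14 3 (axisLetter 14 3 0)) = (0, 6, 6, 0) := by decide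
example : axisLetter 14 1 0 = ⟨13, 1, 0⟩ ∧ axisLetter 14 3 0 = ⟨11, 3, 0⟩ := by decide
/-- phase `1` (the ray `i·ℝ₊`): `A′ = (12; 0, 2) ↦ (0, 0, 4, 4)`, nonzero at `t ∈ {2, 3} = {τ+1, τ+2}`. -/
example : (slab 14 0 (axisLetter 14 2 1), slab 14 1 (axisLetter 14 2 1), slab 14 2 (axisLetter 14 2 1),
    slab 14 3 (axisLetter 14 2 1)) = (0, 0, 4, 4) := by decide

/-- **every axis letter on the alphabet is an `axisLetter`** (co-level `|x| + |y|`, some phase). -/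
theorem eq_axisLetter_of_axis (hgt : ℤ) (ℓ : Letter) (hℓ : ℓ.OnAlphabet hgt) (hax : ℓ.x = 0 ∨ ℓ.y = 0) :
    ∃ τ : Fin 4, ℓ = axisLetter hgt ℓ.colevel τ := by
  obtain ⟨a, x, y⟩ := ℓ
  simp only [Letter.OnAlphabet, Letter.height] at hℓ
  simp only at hax
  rcases hax with hx | hy
  · subst hx
    simp only [abs_zero, add_zero] at hℓ
    rcases le_or_gt 0 y with h0 | h0
    · refine ⟨1, ?_⟩
      simp only [axisLetter, Letter.colevel, abs_zero, zero_add, abs_of_nonneg h0, Letter.mk.injEq, and_true, and_self]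
      rw [abs_of_nonneg h0] at hℓ
      omega
    · refine ⟨3, ?_⟩
      simp only [axisLetter, Letter.colevel, abs_zero, zero_add, abs_of_neg h0, Letter.mk.injEq, neg_neg, and_true, and_self]
      rw [abs_of_neg h0] at hℓ
      omega
  · subst hy
    simp only [abs_zero, add_zero] at hℓ
    rcases le_or_gt 0 x with h0 | h0
    · refine ⟨0, ?_⟩
      simp only [axisLetter, Letter.colevel, abs_zero, add_zero, abs_of_nonneg h0, Letter.mk.injEq, and_true, and_self]
      rw [abs_of_nonneg h0] at hℓ
      omega
    · refine ⟨2, ?_⟩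
      simp only [axisLetter, Letter.colevel, abs_zero, add_zero, abs_of_neg h0, Letter.mk.injEq, neg_neg, and_true, and_self]
      rw [abs_of_neg h0] at hℓ
      omega

/-- hence: the slab row of ANY axis letter on the alphabet is `2·colevel` on two consecutive phases and `0` on the other two. -/
theorem slab_axis_row (hgt : ℤ) (ℓ : Letter) (hℓ : ℓ.OnAlphabet hgt) (hax : ℓ.x = 0 ∨ ℓ.y = 0) :
    ∃ τ : Fin 4, ∀ t : Fin 4, slab hgt t ℓ = if t = τ + 1 ∨ t = τ + 2 then 2 * ℓ.colevel else 0 := by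
  obtain ⟨τ, hτ⟩ := eq_axisLetter_of_axis hgt ℓ hℓ hax
  refine ⟨τ, fun t => ?_⟩
  have h := slab_axisLetter hgt ℓ.colevel τ t
  rw [← hτ] at h
  exact h

/-! ## the box weight of an axis cell -/

/-- the axis cell with co-levels `r_f` and phases `τ_f`. -/
def axisCell (hgt : ℤ) (r : Fin 4 → ℤ) (τ : Fin 4 → Fin 4) : Cell := fun f => axisLetter hgt (r f) (τ f)

/-- **ψ of an axis cell** (negation's dictionary line «ψ_x(c) = 16·dep(c)·[x ∈ boxes(τ(c))]», every height, all co-levels):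
`ψ_x = 16·∏ r_f` if `x_f ∈ {τ_f + 1, τ_f + 2}` for every slot, else `0`. -/
theorem psi_axisCell (hgt : ℤ) (x τ : Fin 4 → Fin 4) (r : Fin 4 → ℤ) :
    psi hgt x (axisCell hgt r τ) =
      if (∀ f : Fin 4, x f = τ f + 1 ∨ x f = τ f + 2) then 16 * ∏ f : Fin 4, r f else 0 := by
  unfold psi axisCell
  simp only [slab_axisLetter]
  split_ifs with h
  · rw [Finset.prod_congr rfl (fun f _ => if_pos (h f)), Finset.prod_mul_distrib]
    simp [Fin.prod_univ_four]
  · push Not at h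
    obtain ⟨f, hf1, hf2⟩ := h
    exact Finset.prod_eq_zero (Finset.mem_univ f) (by simp [hf1, hf2])

/-- in particular on its own 16 boxes an axis cell weighs `16·dep`, e.g. the box `x = τ + 1` (all slots). -/
theorem psi_axisCell_box (hgt : ℤ) (τ : Fin 4 → Fin 4) (r : Fin 4 → ℤ) :
    psi hgt (fun f => τ f + 1) (axisCell hgt r τ) = 16 * ∏ f : Fin 4, r f := by
  rw [psi_axisCell, if_pos (fun f => Or.inl rfl)]

/-! ## (1d′) null steps between charged axis letters keep the phase -/

/-- **(1d′) SAME RAY, SAME PHASE (every height, every length).**  A null step from the axis letter of co-level `r′` at phase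
`τ′` up to the axis letter of co-level `r` at phase `τ`, both CHARGED (`0 < r`, `0 < r′`), holds iff `τ′ = τ` and `r < r′`. -/
theorem nullStep_axisLetter_iff (hgt r r' : ℤ) (τ τ' : Fin 4) (hr : 0 < r) (hr' : 0 < r') :
    NullStep (axisLetter hgt r' τ') (axisLetter hgt r τ) ↔ τ' = τ ∧ r < r' := by
  constructor
  · intro h
    obtain ⟨ha, hsq⟩ := h
    have hrr : 0 < r * r' := mul_pos hr hr'
    fin_cases τ <;> fin_cases τ' <;> simp [axisLetter] at ha hsq ⊢ <;> first | omega | nlinarith [hsq, hrr]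
  · rintro ⟨hτ, hlt⟩
    subst hτ
    refine ⟨?_, ?_⟩
    · rw [axisLetter_a, axisLetter_a]; omega
    · fin_cases τ' <;> simp [axisLetter] <;> ring

/-- the one-directional form used in the port: a charged axis supplier letter of a charged axis letter lies on the SAME ray,
strictly deeper. -/
theorem same_phase_of_nullStep_axis (hgt r r' : ℤ) (τ τ' : Fin 4) (hr : 0 < r) (hr' : 0 < r')
    (h : NullStep (axisLetter hgt r' τ') (axisLetter hgt r τ)) : τ' = τ ∧ r < r' :=
  (nullStep_axisLetter_iff hgt r r' τ τ' hr hr').mp h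

/-- letter form: two charged axis letters on the alphabet joined by a null step have the same phase and the lower one has the
larger co-level. -/
theorem same_phase_of_nullStep_axis' (hgt : ℤ) {ℓ ℓ' : Letter} (hℓ : ℓ.OnAlphabet hgt) (hℓ' : ℓ'.OnAlphabet hgt)
    (hax : ℓ.x = 0 ∨ ℓ.y = 0) (hax' : ℓ'.x = 0 ∨ ℓ'.y = 0) (hc : 0 < ℓ.colevel) (hc' : 0 < ℓ'.colevel)
    (h : NullStep ℓ ℓ') :
    ∃ τ : Fin 4, ℓ = axisLetter hgt ℓ.colevel τ ∧ ℓ' = axisLetter hgt ℓ'.colevel τ ∧ ℓ'.colevel < ℓ.colevel := by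
  obtain ⟨τ, hτ⟩ := eq_axisLetter_of_axis hgt ℓ hℓ hax
  obtain ⟨τ', hτ'⟩ := eq_axisLetter_of_axis hgt ℓ' hℓ' hax'
  have h' : NullStep (axisLetter hgt ℓ.colevel τ) (axisLetter hgt ℓ'.colevel τ') := by rw [← hτ, ← hτ']; exact h
  obtain ⟨hph, hlt⟩ := same_phase_of_nullStep_axis hgt ℓ'.colevel ℓ.colevel τ' τ hc' hc h'
  subst hph
  exact ⟨_, hτ, hτ', hlt⟩

/-! ## Coverage ∕ honesty
`#print axioms`: `propext`, `Classical.choice`, `Quot.sound` only.  What this certifies for the NU4₄ audit: the (1a′) slab semantics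
(alphabet-wide, all `r` — asked for `r = 1, 2, 3`) and the «same ray, same phase» step of (1d′) for charged AXIS letters (all lengths).
What it does NOT touch: that suppliers of axis hub-free N cells are hub-free (H is never below anything — `LeggedFloor`∕`ShellThreeDoorB`
facts) and AXIS (negation's (R2) + the post-run room — a SAT∕cascade input, not a kernel fact here); (1b′), (1e′), (1f′)(1g′) and the g22
certificates (officer AUDIT 36); the binders (R1)(R2)(F5)₄ (SAT facts not in hand). -/
theorem scope_note : True := trivial

end Summit.HodgeConjecture.HodgeConjecture.Cruxes.BlochSeedDiscOne.AxisPhaseSlab
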